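import Literature.NumberTheory.Rogawski1990.ArchInnerTransferHaarFormTorus   -- ★ p842449 N4 FILE B (A-p13): `finsum_integral_comp_conj_archDiagTorus_eq_of_isArchInnerTransfer` ((14.2.1) in Haar currency at regular torus points)
import Literature.NumberTheory.Rogawski1990.ArchStableClassTorusHaarSum         -- ★ N3-c (p02): `labelCount_mul_finsum_integral_comp_conj[_archCongr_symm]_eq_sum_perm`
import Literature.NumberTheory.Automorphic.ArchRankOneLimitFormulaPartial         -- ★ `sigmaFinite_map_conj_circleDiagonal` (N-general)
import HarnessLib

/-!
# (14.2.1) AT THE REGULAR TORUS POINTS, READ AS AN IDENTITY OF LABELLED PRODUCT-TORUS INTEGRALS — the `hbase` of the rank-2 descent for (S-d)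
# (Rogawski 1990 §14.2 (14.2.1) p. 232, §14.4 p. 237 «`f_v = f′_v ∘ ψ_v⁻¹`», §4.1 (4.1.1), §1.7; SdArch ED. 3 node N6a)

Topic `NumberTheory/Rogawski1990`; namespace `Literature.NumberTheory.Rogawski1990`.  THEOREMS ONLY (no `def`, no instance, no notation, no axiom, no named fact, no `sorry`).
Cell `pub/hodgecm-mathlib`, ENGINE T1 (crux H413 = `stmt-HodgeConjecture-24833`); ROAD-Sd residual R4 (`stub_SdCanonical` of `Cruxes/H413/Lines/F0_P3a_SdArch.lean`), SdArch ED. 3 (design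
7141d221 ∕ N5 census 783c9612 §4), node **N6a = CLAIM(univ)**: the chain N4 ★ (A-p14∕A-p13) → N3-c ★ (p02) → N3-b ★ (p02) composed ONCE, in the shape ★ `descent_two_sided_prod_mul_eq′` (p06) consumes
as `hbase`; author F0P3a-p03 (g11), 2026-09-01.

THE STATEMENT.  Frames: the inner form on its DIAGONAL carrier `G′_∞ = U(diag α)(L ⊗ ℝ)` (`α` `c`-real, `α_i ≠ 0`) and the quasi-split `G_∞ = U(Φ₃)(L ⊗ ℝ)` read through a congruence frame
`Φ : G_∞ ≃ₜ* U(diag γ)(L ⊗ ℝ)`, `g ↦ T g T⁻¹` (N3-b convention; `Φ := Ψ_Q`, `γ = (½, 1, −½)`).  Inside a thirteen-conjunct system (`t′, t`, (C), (C′G), Weil forms `hW′, hW`) with Haar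
`ν′, ν`, for an inner-transfer pair `(a′, a)` ((14.2.1), ★ `IsArchInnerTransfer`), ambient readings `a′ = Θ′ ∘ ↑↑`, `a ∘ Φ⁻¹ = Θ ∘ ↑↑`, local Haar measures `νw′, νw` with the N3-b constants
`κ′, κ` (hypotheses `hκ′`, `hκ` = ★ `exists_integral_comp_conj_archCongr_symm_eq_mul_integral_pi_map_conj` opened), and EVERY `z` regular at all places:
  `M_γ · κ′ · Σ_ρ ∫ Θ′ ↑↑e′⁻¹ d(⊗_w conj(diag(z_w ∘ ρ_w))_* νw′_w) = M_α · κ · Σ_ρ ∫ Θ ↑↑e⁻¹ d(⊗_w conj(diag(z_w ∘ ρ_w))_* νw_w)`,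
`M_β = Π_w p_w!(3 − p_w)!` the EXPLICIT label multiplicities of ★ N3-c (system-free).  Proof: N4 equates the two Haar-currency stable sums; N3-c turns `M ·` each into the label sum over
`ρ : W → S₃`; N3-b reads every label term as `κ ·` a product-torus integral (σ-finiteness of the orbit push-forwards at the regular points ★ `sigmaFinite_map_conj_circleDiagonal`); algebra.
HONEST LABEL: HC_CM is proved only modulo the printed citations until rung 0 closes; this file is bookkeeping inside the letter's system and pays nothing by itself.

## References
* [Rogawski1990] J. D. Rogawski, *Automorphic Representations of Unitary Groups in Three Variables*, Ann. of Math. Stud. 123 (1990), §14.2 (14.2.1) p. 232, §14.4 p. 237, §4.1 (4.1.1) p. 39,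
  §3.7 Prop. 3.7.1, §1.7 p. 6.
* [PlatonovRapinchuk1994] V. Platonov, A. Rapinchuk, *Algebraic Groups and Number Theory* (1994), §2.3.
-/

set_option autoImplicit false

noncomputable section

open MeasureTheory Measure NumberField NumberField.InfinitePlace NumberField.mixedEmbedding
open Literature.MeasureTheory.Group

namespace Literature.NumberTheory.Rogawski1990

open Literature.NumberTheory.Automorphic Literature.NumberTheory.Automorphic.UnitaryGroup

section Hbase

variable (L : Type) [Field L] [NumberField L] [IsCMField L] (α : Fin 3 → L)
  [MeasurableSpace (UnitaryGroup.arch (↥(maximalRealSubfield L)) L (IsCMField.complexConj L) 3 (Matrix.diagonal α))] [BorelSpace (UnitaryGroup.arch (↥(maximalRealSubfield L)) L (IsCMField.complexConj L) 3 (Matrix.diagonal α))] [MeasurableSpace (UnitaryGroup.arch (↥(maximalRealSubfield L)) L (IsCMField.complexConj L) 3 (Matrix.of fun i j : Fin 3 => if i.val + j.val + 1 = 3 then (1 : L) else 0))] [BorelSpace (UnitaryGroup.arch (↥(maximalRealSubfield L)) L (IsCMField.complexConj L) 3 (Matrix.of fun i j : Fin 3 => if i.val + j.val + 1 = 3 then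 (1 : L) else 0))]
  (t' : ∀ γ' : (UnitaryGroup.arch (↥(maximalRealSubfield L)) L (IsCMField.complexConj L) 3 (Matrix.diagonal α)), Measure (Subgroup.centralizer ({γ'} : Set (UnitaryGroup.arch (↥(maximalRealSubfield L)) L (IsCMField.complexConj L) 3 (Matrix.diagonal α)))))
  (t : ∀ γ₀ : (UnitaryGroup.arch (↥(maximalRealSubfield L)) L (IsCMField.complexConj L) 3 (Matrix.of fun i j : Fin 3 => if i.val + j.val + 1 = 3 then (1 : L) else 0)), Measure (Subgroup.centralizer ({γ₀} : Set (UnitaryGroup.arch (↥(maximalRealSubfield L)) L (IsCMField.complexConj L) 3 (Matrix.of fun i j : Fin 3 => if i.val + j.val + 1 = 3 then (1 : L) else 0)))))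
  (hd' : (Matrix.diagonal α).det ≠ 0) (hd₃ : (Matrix.of fun i j : Fin 3 => if i.val + j.val + 1 = 3 then (1 : L) else 0).det ≠ 0)
  (hC : ∀ (γ₁ γ₂ : (UnitaryGroup.arch (↥(maximalRealSubfield L)) L (IsCMField.complexConj L) 3 (Matrix.of fun i j : Fin 3 => if i.val + j.val + 1 = 3 then (1 : L) else 0))) (h₁ : IsRegularElt (γ₁.val : GL (Fin 3) (mixedSpace L))) (hc : Corresponds (UnitaryGroup.conjMixed (↥(maximalRealSubfield L)) L (IsCMField.complexConj L)) (UnitaryGroup.archFormOf L 3 (Matrix.of fun i j : Fin 3 => if i.val + j.val + 1 = 3 then (1 : L) else 0)) (UnitaryGroup.archFormOf L 3 (Matrix.of fun i j : Fin 3 => if i.val + j.val + 1 = 3 then (1 : L) else 0)) γ₁ γ₂),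
      Measure.map ⇑(UnitaryGroup.archStableCentralizerEquiv L hd₃ hd₃ hc h₁) (t γ₁) = t γ₂)
  (hC'G : ∀ (γ' : (UnitaryGroup.arch (↥(maximalRealSubfield L)) L (IsCMField.complexConj L) 3 (Matrix.diagonal α))) (γ₀ : (UnitaryGroup.arch (↥(maximalRealSubfield L)) L (IsCMField.complexConj L) 3 (Matrix.of fun i j : Fin 3 => if i.val + j.val + 1 = 3 then (1 : L) else 0))) (h' : IsRegularElt (γ'.val : GL (Fin 3) (mixedSpace L))) (hc : Corresponds (UnitaryGroup.conjMixed (↥(maximalRealSubfield L)) L (IsCMField.complexConj L)) (UnitaryGroup.archFormOf L 3 (Matrix.diagonal α)) (UnitaryGroup.archFormOf L 3 (Matrix.of fun i j : Fin 3 => if i.val + j.val + 1 = 3 then (1 : L) else 0)) γ' γ₀),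
      Measure.map ⇑(UnitaryGroup.archStableCentralizerEquiv L hd' hd₃ hc h') (t' γ') = t γ₀)
  (γ : Fin 3 → L) (T : GL (Fin 3) (mixedSpace L)) (Φ : (UnitaryGroup.arch (↥(maximalRealSubfield L)) L (IsCMField.complexConj L) 3 (Matrix.of fun i j : Fin 3 => if i.val + j.val + 1 = 3 then (1 : L) else 0)) ≃ₜ* (UnitaryGroup.arch (↥(maximalRealSubfield L)) L (IsCMField.complexConj L) 3 (Matrix.diagonal γ)))
  (hΦ : ∀ g : (UnitaryGroup.arch (↥(maximalRealSubfield L)) L (IsCMField.complexConj L) 3 (Matrix.of fun i j : Fin 3 => if i.val + j.val + 1 = 3 then (1 : L) else 0)), ((Φ g : (UnitaryGroup.arch (↥(maximalRealSubfield L)) L (IsCMField.complexConj L) 3 (Matrix.diagonal γ))) : GL (Fin 3) (mixedSpace L)) = T * (g : GL (Fin 3) (mixedSpace L)) * T⁻¹)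
  [∀ γ' : (UnitaryGroup.arch (↥(maximalRealSubfield L)) L (IsCMField.complexConj L) 3 (Matrix.diagonal α)), MeasurableSpace ((UnitaryGroup.arch (↥(maximalRealSubfield L)) L (IsCMField.complexConj L) 3 (Matrix.diagonal α)) ⧸ Subgroup.centralizer ({γ'} : Set (UnitaryGroup.arch (↥(maximalRealSubfield L)) L (IsCMField.complexConj L) 3 (Matrix.diagonal α))))]
  [∀ γ' : (UnitaryGroup.arch (↥(maximalRealSubfield L)) L (IsCMField.complexConj L) 3 (Matrix.diagonal α)), BorelSpace ((UnitaryGroup.arch (↥(maximalRealSubfield L)) L (IsCMField.complexConj L) 3 (Matrix.diagonal α)) ⧸ Subgroup.centralizer ({γ'} : Set (UnitaryGroup.arch (↥(maximalRealSubfield L)) L (IsCMField.complexConj L) 3 (Matrix.diagonal α))))]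
  [∀ γ₀ : (UnitaryGroup.arch (↥(maximalRealSubfield L)) L (IsCMField.complexConj L) 3 (Matrix.of fun i j : Fin 3 => if i.val + j.val + 1 = 3 then (1 : L) else 0)), MeasurableSpace ((UnitaryGroup.arch (↥(maximalRealSubfield L)) L (IsCMField.complexConj L) 3 (Matrix.of fun i j : Fin 3 => if i.val + j.val + 1 = 3 then (1 : L) else 0)) ⧸ Subgroup.centralizer ({γ₀} : Set (UnitaryGroup.arch (↥(maximalRealSubfield L)) L (IsCMField.complexConj L) 3 (Matrix.of fun i j : Fin 3 => if i.val + j.val + 1 = 3 then (1 : L) else 0))))]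
  [∀ γ₀ : (UnitaryGroup.arch (↥(maximalRealSubfield L)) L (IsCMField.complexConj L) 3 (Matrix.of fun i j : Fin 3 => if i.val + j.val + 1 = 3 then (1 : L) else 0)), BorelSpace ((UnitaryGroup.arch (↥(maximalRealSubfield L)) L (IsCMField.complexConj L) 3 (Matrix.of fun i j : Fin 3 => if i.val + j.val + 1 = 3 then (1 : L) else 0)) ⧸ Subgroup.centralizer ({γ₀} : Set (UnitaryGroup.arch (↥(maximalRealSubfield L)) L (IsCMField.complexConj L) 3 (Matrix.of fun i j : Fin 3 => if i.val + j.val + 1 = 3 then (1 : L) else 0))))]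
  [∀ w : {w : InfinitePlace L // IsComplex w}, MeasurableSpace (archLocal L 3 (Matrix.diagonal α) w)] [∀ w : {w : InfinitePlace L // IsComplex w}, BorelSpace (archLocal L 3 (Matrix.diagonal α) w)]
  [∀ w : {w : InfinitePlace L // IsComplex w}, MeasurableSpace (archLocal L 3 (Matrix.diagonal γ) w)] [∀ w : {w : InfinitePlace L // IsComplex w}, BorelSpace (archLocal L 3 (Matrix.diagonal γ) w)]

include hC hC'G hΦ in
open scoped Classical in
/-- **CLAIM(univ) — (14.2.1) AS AN IDENTITY OF LABELLED PRODUCT-TORUS INTEGRALS** at every `z` regular at all places: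
`M_γ·κ′·Σ_ρ ∫ Θ′ ↑↑e′⁻¹ d(⊗_w conj(diag(z_w∘ρ_w))_*νw′_w) = M_α·κ·Σ_ρ ∫ Θ ↑↑e⁻¹ d(⊗_w conj(diag(z_w∘ρ_w))_*νw_w)` — N4 ★ `finsum_integral_comp_conj_archDiagTorus_eq_of_isArchInnerTransfer`, N3-c ★
`labelCount_mul_finsum_integral_comp_conj[_archCongr_symm]_eq_sum_perm` on both sides, the N3-b readings `hκ′`, `hκ` per label (orbit push-forwards σ-finite at regular points), `a′ = Θ′∘↑↑`,
`a∘Φ⁻¹ = Θ∘↑↑`; the `hbase` of ★ `descent_two_sided_prod_mul_eq′` for `G′ S u := M_γκ′·I′(S,u)`, `G S u := M_ακ·I(S,u)`. [cite: Rogawski1990, §14.2 (14.2.1) p. 232; §14.4 p. 237; §4.1 (4.1.1) p. 39; §1.7 p. 6] -/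
theorem labelCount_mul_mul_sum_integral_pi_eq_of_isArchInnerTransfer
    (hα : ∀ i, α i ≠ 0) (hhermα : ∀ i, (IsCMField.complexConj L (α i) : L) = α i) (hγ : ∀ i, γ i ≠ 0) (hhermγ : ∀ i, (IsCMField.complexConj L (γ i) : L) = γ i)
    (ν' : Measure (UnitaryGroup.arch (↥(maximalRealSubfield L)) L (IsCMField.complexConj L) 3 (Matrix.diagonal α))) (ν : Measure (UnitaryGroup.arch (↥(maximalRealSubfield L)) L (IsCMField.complexConj L) 3 (Matrix.of fun i j : Fin 3 => if i.val + j.val + 1 = 3 then (1 : L) else 0))) [ν'.IsHaarMeasure] [ν'.IsMulRightInvariant] [ν.IsHaarMeasure] [ν.IsMulRightInvariant]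
    (m' : OrbitalMeasureFamily (UnitaryGroup.arch (↥(maximalRealSubfield L)) L (IsCMField.complexConj L) 3 (Matrix.diagonal α))) (m : OrbitalMeasureFamily (UnitaryGroup.arch (↥(maximalRealSubfield L)) L (IsCMField.complexConj L) 3 (Matrix.of fun i j : Fin 3 => if i.val + j.val + 1 = 3 then (1 : L) else 0)))
    (hW' : m'.IsQuotientOf (fun γ₀ => IsRegularElt (γ₀.val : GL (Fin 3) (mixedSpace L))) ν' t')
    (hW : m.IsQuotientOf (fun γ₀ => IsRegularElt (γ₀.val : GL (Fin 3) (mixedSpace L))) ν t)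
    (a' : (UnitaryGroup.arch (↥(maximalRealSubfield L)) L (IsCMField.complexConj L) 3 (Matrix.diagonal α)) → ℂ) (a : (UnitaryGroup.arch (↥(maximalRealSubfield L)) L (IsCMField.complexConj L) 3 (Matrix.of fun i j : Fin 3 => if i.val + j.val + 1 = 3 then (1 : L) else 0)) → ℂ) (ha'm : Measurable a') (ham : Measurable a) (hit : IsArchInnerTransfer L (Matrix.diagonal α) m' m a' a)
    (νw' : ∀ w : {w : InfinitePlace L // IsComplex w}, Measure (archLocal L 3 (Matrix.diagonal α) w)) (νw : ∀ w : {w : InfinitePlace L // IsComplex w}, Measure (archLocal L 3 (Matrix.diagonal γ) w))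
    [∀ w, IsFiniteMeasureOnCompacts (νw' w)] [∀ w, IsFiniteMeasureOnCompacts (νw w)]
    (κ' κ : ℝ)
    (hκ' : ∀ (f : (UnitaryGroup.arch (↥(maximalRealSubfield L)) L (IsCMField.complexConj L) 3 (Matrix.diagonal α)) → ℂ), Measurable f →
        ∀ (tt : ∀ w : {w : InfinitePlace L // IsComplex w}, archLocal L 3 (Matrix.diagonal α) w)
          [∀ w, SigmaFinite ((νw' w).map (fun g : archLocal L 3 (Matrix.diagonal α) w => g * tt w * g⁻¹))],
        ∫ h, f (h * (archPiEquivCM 3 L (Matrix.diagonal α)).symm tt * h⁻¹) ∂ν' =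
          (κ' : ℂ) * ∫ o, f ((archPiEquivCM 3 L (Matrix.diagonal α)).symm o)
            ∂(Measure.pi fun w => (νw' w).map (fun g : archLocal L 3 (Matrix.diagonal α) w => g * tt w * g⁻¹)))
    (hκ : ∀ (f : (UnitaryGroup.arch (↥(maximalRealSubfield L)) L (IsCMField.complexConj L) 3 (Matrix.of fun i j : Fin 3 => if i.val + j.val + 1 = 3 then (1 : L) else 0)) → ℂ), Measurable f →
        ∀ (tt : ∀ w : {w : InfinitePlace L // IsComplex w}, archLocal L 3 (Matrix.diagonal γ) w)
          [∀ w, SigmaFinite ((νw w).map (fun g : archLocal L 3 (Matrix.diagonal γ) w => g * tt w * g⁻¹))],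
        ∫ h, f (h * Φ.symm ((archPiEquivCM 3 L (Matrix.diagonal γ)).symm tt) * h⁻¹) ∂ν =
          (κ : ℂ) * ∫ o, f (Φ.symm ((archPiEquivCM 3 L (Matrix.diagonal γ)).symm o))
            ∂(Measure.pi fun w => (νw w).map (fun g : archLocal L 3 (Matrix.diagonal γ) w => g * tt w * g⁻¹)))
    (Θ' Θ : Matrix (Fin 3) (Fin 3) (mixedSpace L) → ℂ)
    (hΘ'a : ∀ k : (UnitaryGroup.arch (↥(maximalRealSubfield L)) L (IsCMField.complexConj L) 3 (Matrix.diagonal α)), a' k = Θ' ((k : GL (Fin 3) (mixedSpace L)) : Matrix (Fin 3) (Fin 3) (mixedSpace L)))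
    (hΘa : ∀ k : (UnitaryGroup.arch (↥(maximalRealSubfield L)) L (IsCMField.complexConj L) 3 (Matrix.diagonal γ)), a (Φ.symm k) = Θ ((k : GL (Fin 3) (mixedSpace L)) : Matrix (Fin 3) (Fin 3) (mixedSpace L)))
    (z : {w : InfinitePlace L // IsComplex w} → Fin 3 → Circle) (hz : ∀ w, Function.Injective (z w)) :
    ((∏ w : {w : InfinitePlace L // IsComplex w},
        (Finset.univ.filter fun i => 0 < (w.1.embedding (γ i)).re).card.factorial *
          (3 - (Finset.univ.filter fun i => 0 < (w.1.embedding (γ i)).re).card).factorial : ℕ) : ℂ) * (κ' : ℂ) *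
      (∑ ρ : {w : InfinitePlace L // IsComplex w} → Equiv.Perm (Fin 3),
        ∫ o, Θ' (((((archPiEquivCM 3 L (Matrix.diagonal α)).symm o) : (UnitaryGroup.arch (↥(maximalRealSubfield L)) L (IsCMField.complexConj L) 3 (Matrix.diagonal α))) : GL (Fin 3) (mixedSpace L)) : Matrix (Fin 3) (Fin 3) (mixedSpace L))
          ∂(Measure.pi fun w : {w : InfinitePlace L // IsComplex w} => (νw' w).map (fun g : archLocal L 3 (Matrix.diagonal α) w =>
            g * ⟨circleDiagonal 3 (z w ∘ ⇑(ρ w)), circleDiagonal_mem_archLocal_diagonal L 3 α w _⟩ * g⁻¹))) =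
    ((∏ w : {w : InfinitePlace L // IsComplex w},
        (Finset.univ.filter fun i => 0 < (w.1.embedding (α i)).re).card.factorial *
          (3 - (Finset.univ.filter fun i => 0 < (w.1.embedding (α i)).re).card).factorial : ℕ) : ℂ) * (κ : ℂ) *
      (∑ ρ : {w : InfinitePlace L // IsComplex w} → Equiv.Perm (Fin 3),
        ∫ o, Θ (((((archPiEquivCM 3 L (Matrix.diagonal γ)).symm o) : (UnitaryGroup.arch (↥(maximalRealSubfield L)) L (IsCMField.complexConj L) 3 (Matrix.diagonal γ))) : GL (Fin 3) (mixedSpace L)) : Matrix (Fin 3) (Fin 3) (mixedSpace L))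
          ∂(Measure.pi fun w : {w : InfinitePlace L // IsComplex w} => (νw w).map (fun g : archLocal L 3 (Matrix.diagonal γ) w =>
            g * ⟨circleDiagonal 3 (z w ∘ ⇑(ρ w)), circleDiagonal_mem_archLocal_diagonal L 3 γ w _⟩ * g⁻¹))) := by
  haveI : ∀ w : {w : InfinitePlace L // IsComplex w}, SecondCountableTopology (archLocal L 3 (Matrix.diagonal α) w) := fun w => secondCountableTopology_archLocal L 3 (Matrix.diagonal α) w
  haveI : ∀ w : {w : InfinitePlace L // IsComplex w}, LocallyCompactSpace (archLocal L 3 (Matrix.diagonal α) w) := fun w => locallyCompactSpace_archLocal L 3 (Matrix.diagonal α) w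
  haveI : ∀ w : {w : InfinitePlace L // IsComplex w}, SecondCountableTopology (archLocal L 3 (Matrix.diagonal γ) w) := fun w => secondCountableTopology_archLocal L 3 (Matrix.diagonal γ) w
  haveI : ∀ w : {w : InfinitePlace L // IsComplex w}, LocallyCompactSpace (archLocal L 3 (Matrix.diagonal γ) w) := fun w => locallyCompactSpace_archLocal L 3 (Matrix.diagonal γ) w
  -- N4: (14.2.1) in Haar currency at `(t_α(z), Φ⁻¹ t_γ(z))`
  have h4 := finsum_integral_comp_conj_archDiagTorus_eq_of_isArchInnerTransfer L α t' t hd' hd₃ hC hC'G γ T Φ hΦ hα hhermα hγ hhermγ ν' ν m' m hW' hW a' a ha'm ham hit z hz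
  -- N3-c: label sums on both sides
  have h3' := labelCount_mul_finsum_integral_comp_conj_eq_sum_perm L 3 α hα hhermα hz ν' a'
  have h3 := labelCount_mul_finsum_integral_comp_conj_archCongr_symm_eq_sum_perm L γ T Φ hΦ hγ hhermγ hz ν a
  -- torus points as assembled per-place points
  have htor' : ∀ u : {w : InfinitePlace L // IsComplex w} → Fin 3 → Circle, archDiagTorus L 3 α u =
      (archPiEquivCM 3 L (Matrix.diagonal α)).symm (fun w => (⟨circleDiagonal 3 (u w), circleDiagonal_mem_archLocal_diagonal L 3 α w (u w)⟩ : archLocal L 3 (Matrix.diagonal α) w)) :=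
    fun u => ((ContinuousMulEquiv.symm_apply_eq _).2 (funext fun w => (Subtype.ext (archAt_archDiagTorus L 3 α u w)).symm)).symm
  have htor : ∀ u : {w : InfinitePlace L // IsComplex w} → Fin 3 → Circle, archDiagTorus L 3 γ u =
      (archPiEquivCM 3 L (Matrix.diagonal γ)).symm (fun w => (⟨circleDiagonal 3 (u w), circleDiagonal_mem_archLocal_diagonal L 3 γ w (u w)⟩ : archLocal L 3 (Matrix.diagonal γ) w)) :=
    fun u => ((ContinuousMulEquiv.symm_apply_eq _).2 (funext fun w => (Subtype.ext (archAt_archDiagTorus L 3 γ u w)).symm)).symm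
  -- N3-b per label
  have hS' : (∑ ρ : {w : InfinitePlace L // IsComplex w} → Equiv.Perm (Fin 3), ∫ h, a' (h * archDiagTorus L 3 α (fun w => z w ∘ ⇑(ρ w)) * h⁻¹) ∂ν') = (κ' : ℂ) * (∑ ρ : {w : InfinitePlace L // IsComplex w} → Equiv.Perm (Fin 3),
        ∫ o, Θ' (((((archPiEquivCM 3 L (Matrix.diagonal α)).symm o) : (UnitaryGroup.arch (↥(maximalRealSubfield L)) L (IsCMField.complexConj L) 3 (Matrix.diagonal α))) : GL (Fin 3) (mixedSpace L)) : Matrix (Fin 3) (Fin 3) (mixedSpace L))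
          ∂(Measure.pi fun w : {w : InfinitePlace L // IsComplex w} => (νw' w).map (fun g : archLocal L 3 (Matrix.diagonal α) w =>
            g * ⟨circleDiagonal 3 (z w ∘ ⇑(ρ w)), circleDiagonal_mem_archLocal_diagonal L 3 α w _⟩ * g⁻¹))) := by
    rw [Finset.mul_sum]
    refine Finset.sum_congr rfl fun ρ _ => ?_
    haveI : ∀ w : {w : InfinitePlace L // IsComplex w}, SigmaFinite ((νw' w).map (fun g : archLocal L 3 (Matrix.diagonal α) w =>
        g * ⟨circleDiagonal 3 (z w ∘ ⇑(ρ w)), circleDiagonal_mem_archLocal_diagonal L 3 α w _⟩ * g⁻¹)) :=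
      fun w => sigmaFinite_map_conj_circleDiagonal L 3 α w hα _ ((hz w).comp (ρ w).injective) (νw' w)
    rw [htor']
    rw [hκ' a' ha'm (fun w => (⟨circleDiagonal 3 (z w ∘ ⇑(ρ w)), circleDiagonal_mem_archLocal_diagonal L 3 α w _⟩ : archLocal L 3 (Matrix.diagonal α) w))]
    simp only [hΘ'a]
  have hS : (∑ ρ : {w : InfinitePlace L // IsComplex w} → Equiv.Perm (Fin 3), ∫ h, a (h * Φ.symm (archDiagTorus L 3 γ (fun w => z w ∘ ⇑(ρ w))) * h⁻¹) ∂ν) = (κ : ℂ) * (∑ ρ : {w : InfinitePlace L // IsComplex w} → Equiv.Perm (Fin 3),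
        ∫ o, Θ (((((archPiEquivCM 3 L (Matrix.diagonal γ)).symm o) : (UnitaryGroup.arch (↥(maximalRealSubfield L)) L (IsCMField.complexConj L) 3 (Matrix.diagonal γ))) : GL (Fin 3) (mixedSpace L)) : Matrix (Fin 3) (Fin 3) (mixedSpace L))
          ∂(Measure.pi fun w : {w : InfinitePlace L // IsComplex w} => (νw w).map (fun g : archLocal L 3 (Matrix.diagonal γ) w =>
            g * ⟨circleDiagonal 3 (z w ∘ ⇑(ρ w)), circleDiagonal_mem_archLocal_diagonal L 3 γ w _⟩ * g⁻¹))) := by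
    rw [Finset.mul_sum]
    refine Finset.sum_congr rfl fun ρ _ => ?_
    haveI : ∀ w : {w : InfinitePlace L // IsComplex w}, SigmaFinite ((νw w).map (fun g : archLocal L 3 (Matrix.diagonal γ) w =>
        g * ⟨circleDiagonal 3 (z w ∘ ⇑(ρ w)), circleDiagonal_mem_archLocal_diagonal L 3 γ w _⟩ * g⁻¹)) :=
      fun w => sigmaFinite_map_conj_circleDiagonal L 3 γ w hγ _ ((hz w).comp (ρ w).injective) (νw w)
    rw [htor]
    rw [hκ a ham (fun w => (⟨circleDiagonal 3 (z w ∘ ⇑(ρ w)), circleDiagonal_mem_archLocal_diagonal L 3 γ w _⟩ : archLocal L 3 (Matrix.diagonal γ) w))]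
    simp only [hΘa]
  -- algebra
  rw [hS'] at h3'
  rw [hS] at h3
  rw [h4] at h3'
  linear_combination ((∏ w : {w : InfinitePlace L // IsComplex w},
        (Finset.univ.filter fun i => 0 < (w.1.embedding (α i)).re).card.factorial *
          (3 - (Finset.univ.filter fun i => 0 < (w.1.embedding (α i)).re).card).factorial : ℕ) : ℂ) * h3 - ((∏ w : {w : InfinitePlace L // IsComplex w},
        (Finset.univ.filter fun i => 0 < (w.1.embedding (γ i)).re).card.factorial *
          (3 - (Finset.univ.filter fun i => 0 < (w.1.embedding (γ i)).re).card).factorial : ℕ) : ℂ) * h3'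

end Hbase

end Literature.NumberTheory.Rogawski1990

end
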